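import Mathlib
import Summits.NavierStokesRegularity.NavierStokesRegularity.Theorems.L3TimeExponentPincerBallAverage
import HarnessLib.Audit
import HarnessLib

/-!
# The Morrey–energy–dissipation interpolation inequality `(∫|f|³)² ≤ (576 M₂/V₁) ‖f‖₂² ‖∇f‖₂²` on `ℝ³`
# (route `L3TimeExponentPincer`, item `stmt-NavierStokesRegularity-19499`; support file 2/3 of
# "THEOREM J′ unconditional")

Support file (cell ns-regularity-ideate, seat p4, gen 4).  Pure real analysis, 0 `sorry`, no definitions.

**THE SLICE INEQUALITY** (`lintegral_cube_sq_le_of_morrey`): if `f : ℝ³ → ℝ³` is `C¹`, `‖f‖₂ < ∞`, and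
`∫_{B̄(x₀,ρ)} |f|² ≤ M₂ ρ` for ALL centres and radii (the scale-invariant Morrey bound `M^{2,1}`), then
`(∫ |f|³)² ≤ (576 M₂ / V₁) · ∫|f|² · ∫‖Df‖²`, i.e. `‖f‖₃³ ≤ 24 √(M₂/V₁) ‖f‖₂ ‖∇f‖₂` (`V₁ = |B(0,1)|`).

This is an ELEMENTARY substitute for the route nsreg-p2 took through Maz'ya's `W^{1,1}` trace inequality
(`∫|f|³ = ∫ |f|·|f|² ≤ c K ‖∇|f|²‖₁ ≤ 2cK ‖f‖₂‖∇f‖₂`, `K ≍ √M₂` the 2-growth constant of `|f| dx`; Maz'ya 1985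
§1.4.2 Thm 2 = Meyers–Ziemer 1977, whose proof needs the coarea formula / Gustin's boxing inequality, absent from
Mathlib — hence the named fact `Literature.Analysis.FunctionSpaces.MazyaTraceD` and the CONDITIONAL theorem J′
`L3TimeExponentPincerJawFullMorrey.jawUpToSix_of_mazya`).  Proof here (real-variable, no Fourier, no coarea):
layer cake `∫|f|³ = 3∫₀^∞ t² |{|f|>t}| dt` (`lintegral_cube_eq_layerCake`); at level `t` split
`f = A_ρ f + (f - A_ρ f)` with the ball average at scale `ρ(t) = 2√(M₂/V₁)/t`, so that the Morrey bound gives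
`‖A_ρ f‖_∞ ≤ t/2` (`norm_ballAvg_sq_le`) and Chebyshev + `‖f - A_ρ f‖₂ ≤ ρ‖∇f‖₂` give
`|{|f|>t}| (t/2)² ≤ ρ(t)² ‖∇f‖₂²` (`meas_gt_mul_le_of_morrey`), i.e. `t²|{|f|>t}| ≤ 16 M₂ ‖∇f‖₂²/(V₁ t²)`; small
levels use `t² |{|f|>t}| ≤ ‖f‖₂²` (`meas_gt_mul_le_energy`); integrating below/above a split level `Λ` gives
`∫|f|³ ≤ 3(‖f‖₂² Λ + 16 M₂ ‖∇f‖₂²/(V₁ Λ))` (`lintegral_cube_le_split`) and optimising in `Λ`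
(`sq_le_of_forall_le_linear_add_inv`) the claim.  Scaling check: all three factors are critical
(`f ↦ λ f(λ·)` leaves `M₂`, `‖f‖₃` and `‖f‖₂‖∇f‖₂` invariant).  Nearest print: the "refined Sobolev inequality"
`‖f‖_{L³} ≲ ‖f‖_{Ḣ^{1/2}}^{2/3} ‖f‖_{Ḃ^{-1}_{∞,∞}}^{1/3}` (Gérard–Meyer–Oru 1997; Bahouri–Chemin–Danchin, *Fourier
Analysis and Nonlinear PDE*, Thm 1.43) together with `M^{2,1} ⊂ Ḃ^{-1}_{∞,∞}`; the version here avoids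
Littlewood–Paley theory by using ball averages as the low-frequency part.
-/

noncomputable section

namespace Summit.NavierStokesRegularity.NavierStokesRegularity.Theorems.L3TimeExponentPincerMorreyInterpolation

open MeasureTheory Set Function Filter Metric Topology
open scoped ENNReal NNReal
open Literature.Analysis.FluidPDE
open Summit.NavierStokesRegularity.NavierStokesRegularity.Theorems.L3TimeExponentPincerMorreyGrowth (V₁ V₁_nonneg volume_ball_eq)
open Summit.NavierStokesRegularity.NavierStokesRegularity.Theorems.L3TimeExponentPincerBallAverage

/-! ### §3  Distribution-function bounds and the layer cake -/

/-- **Low part, pointwise**: under the Morrey bound `∫_{B̄(x₀,ρ)} |f|² ≤ M₂ ρ` (all centres, all radii),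
`‖A_ρ f(x)‖² ≤ M₂ / (V₁ ρ²)`. -/
theorem norm_ballAvg_sq_le {f : (EuclideanSpace ℝ (Fin 3)) → (EuclideanSpace ℝ (Fin 3))} (hf : Continuous f)
    {M₂ : ℝ} (hM₂ : 0 ≤ M₂)
    (hMor : ∀ (x₀ : EuclideanSpace ℝ (Fin 3)) (ρ : ℝ), 0 < ρ →
      ∫⁻ y in closedBall x₀ ρ, ‖f y‖ₑ ^ 2 ≤ ENNReal.ofReal (M₂ * ρ))
    (x : EuclideanSpace ℝ (Fin 3)) {ρ : ℝ} (hρ : 0 < ρ) :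
    ‖(volume (closedBall (0 : EuclideanSpace ℝ (Fin 3)) ρ)).toReal⁻¹ •
        ∫ z in closedBall (0 : EuclideanSpace ℝ (Fin 3)) ρ, f (x + z)‖ ^ 2 ≤ M₂ / (V₁ * ρ ^ 2) := by
  have hV : 0 < V₁ := by
    rw [V₁]
    exact ENNReal.toReal_pos (measure_ball_pos volume (0 : EuclideanSpace ℝ (Fin 3)) one_pos).ne'
      measure_ball_lt_top.ne
  have h := enorm_ballAvg_sq_le hf x hρ
  have h2 : ‖(volume (closedBall (0 : EuclideanSpace ℝ (Fin 3)) ρ)).toReal⁻¹ •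
      ∫ z in closedBall (0 : EuclideanSpace ℝ (Fin 3)) ρ, f (x + z)‖ₑ ^ 2 ≤ ENNReal.ofReal (M₂ / (V₁ * ρ ^ 2)) := by
    refine h.trans ?_
    rw [volume_closedBall_eq 0 hρ]
    calc (ENNReal.ofReal (ρ ^ 3 * V₁))⁻¹ * ∫⁻ y in closedBall x ρ, ‖f y‖ₑ ^ 2
        ≤ (ENNReal.ofReal (ρ ^ 3 * V₁))⁻¹ * ENNReal.ofReal (M₂ * ρ) := by gcongr; exact hMor x ρ hρ
      _ = ENNReal.ofReal (M₂ / (V₁ * ρ ^ 2)) := by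
          rw [← ENNReal.ofReal_inv_of_pos (by positivity), ← ENNReal.ofReal_mul (by positivity)]
          congr 1
          field_simp
  rw [← ofReal_norm, ← ENNReal.ofReal_pow (norm_nonneg _)] at h2
  exact (ENNReal.ofReal_le_ofReal_iff (by positivity)).1 h2

/-- **Chebyshev at level `l` after splitting off the average at scale `ρ = 2√(M₂/V₁)/l`**:
`|{‖f‖ > l}| · (l/2)² ≤ ρ² ‖∇f‖₂²`. -/
theorem meas_gt_mul_le_of_morrey {f : (EuclideanSpace ℝ (Fin 3)) → (EuclideanSpace ℝ (Fin 3))} (hf : ContDiff ℝ 1 f)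
    {M₂ : ℝ} (hM₂ : 0 < M₂)
    (hMor : ∀ (x₀ : EuclideanSpace ℝ (Fin 3)) (ρ : ℝ), 0 < ρ →
      ∫⁻ y in closedBall x₀ ρ, ‖f y‖ₑ ^ 2 ≤ ENNReal.ofReal (M₂ * ρ))
    {l : ℝ} (hl : 0 < l) :
    volume {x | l < ‖f x‖} * ENNReal.ofReal ((l / 2) ^ 2) ≤
      ENNReal.ofReal ((2 * Real.sqrt (M₂ / V₁) / l) ^ 2) * ∫⁻ x, ‖fderiv ℝ f x‖ₑ ^ 2 := by
  have hV : 0 < V₁ := by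
    rw [V₁]
    exact ENNReal.toReal_pos (measure_ball_pos volume (0 : EuclideanSpace ℝ (Fin 3)) one_pos).ne'
      measure_ball_lt_top.ne
  have hfc : Continuous f := hf.continuous
  set ρ : ℝ := 2 * Real.sqrt (M₂ / V₁) / l with hρdef
  have hρ : 0 < ρ := by positivity
  set K : Set (EuclideanSpace ℝ (Fin 3)) := closedBall 0 ρ with hK
  set A : (EuclideanSpace ℝ (Fin 3)) → (EuclideanSpace ℝ (Fin 3)) :=
    fun x => (volume K).toReal⁻¹ • ∫ z in K, f (x + z) with hA
  -- the average is continuous and uniformly small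
  have hAc : Continuous A := by
    have h1 : Continuous (uncurry fun (x z : EuclideanSpace ℝ (Fin 3)) => f (x + z)) :=
      hfc.comp (continuous_fst.add continuous_snd)
    exact (continuous_parametric_integral_of_continuous (μ := volume) h1 (isCompact_closedBall _ _)).const_smul
      ((volume K).toReal⁻¹ : ℝ)
  have hρsq : M₂ / (V₁ * ρ ^ 2) = (l / 2) ^ 2 := by
    rw [hρdef, div_pow, mul_pow, Real.sq_sqrt (by positivity)]
    field_simp
  have hlow : ∀ x, ‖A x‖ ≤ l / 2 := by
    intro x
    have h := norm_ballAvg_sq_le hfc hM₂.le hMor x hρ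
    rw [hρsq] at h
    exact (pow_le_pow_iff_left₀ (norm_nonneg _) (by positivity) two_ne_zero).1 h
  -- `{‖f‖ > l} ⊆ {‖f - A f‖² ≥ (l/2)²}`
  have hsub : {x | l < ‖f x‖} ⊆ {x | ENNReal.ofReal ((l / 2) ^ 2) ≤ ‖f x - A x‖ₑ ^ 2} := by
    intro x hx
    simp only [mem_setOf_eq] at hx ⊢
    have h1 : l / 2 ≤ ‖f x - A x‖ := by
      have := norm_sub_norm_le (f x) (A x)
      have h2 : ‖f x‖ - ‖A x‖ ≤ ‖f x - A x‖ := by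
        have := norm_le_norm_add_norm_sub' (f x) (A x)  -- ‖f x‖ ≤ ‖A x‖ + ‖f x - A x‖
        linarith
      linarith [hlow x]
    rw [← ofReal_norm, ← ENNReal.ofReal_pow (norm_nonneg _)]
    exact ENNReal.ofReal_le_ofReal (pow_le_pow_left₀ (by positivity) h1 2)
  have hmeas : AEMeasurable (fun x => ‖f x - A x‖ₑ ^ 2) volume :=
    ((hfc.sub hAc).measurable.enorm.pow_const 2).aemeasurable
  calc volume {x | l < ‖f x‖} * ENNReal.ofReal ((l / 2) ^ 2)
      ≤ volume {x | ENNReal.ofReal ((l / 2) ^ 2) ≤ ‖f x - A x‖ₑ ^ 2} * ENNReal.ofReal ((l / 2) ^ 2) := by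
        gcongr
    _ = ENNReal.ofReal ((l / 2) ^ 2) * volume {x | ENNReal.ofReal ((l / 2) ^ 2) ≤ ‖f x - A x‖ₑ ^ 2} :=
        mul_comm _ _
    _ ≤ ∫⁻ x, ‖f x - A x‖ₑ ^ 2 := mul_meas_ge_le_lintegral₀ hmeas _
    _ ≤ ENNReal.ofReal (ρ ^ 2) * ∫⁻ x, ‖fderiv ℝ f x‖ₑ ^ 2 := lintegral_enorm_sub_ballAvg_sq_le hf hρ

/-- **Chebyshev at level `l`, energy version**: `|{‖f‖ > l}| · l² ≤ ‖f‖₂²`. -/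
theorem meas_gt_mul_le_energy {f : (EuclideanSpace ℝ (Fin 3)) → (EuclideanSpace ℝ (Fin 3))} (hf : Continuous f)
    {l : ℝ} (hl : 0 < l) :
    volume {x | l < ‖f x‖} * ENNReal.ofReal (l ^ 2) ≤ ∫⁻ x, ‖f x‖ₑ ^ 2 := by
  have hsub : {x | l < ‖f x‖} ⊆ {x | ENNReal.ofReal (l ^ 2) ≤ ‖f x‖ₑ ^ 2} := by
    intro x hx
    simp only [mem_setOf_eq] at hx ⊢
    rw [← ofReal_norm, ← ENNReal.ofReal_pow (norm_nonneg _)]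
    exact ENNReal.ofReal_le_ofReal (pow_le_pow_left₀ hl.le hx.le 2)
  have hmeas : AEMeasurable (fun x => ‖f x‖ₑ ^ 2) volume := (hf.measurable.enorm.pow_const 2).aemeasurable
  calc volume {x | l < ‖f x‖} * ENNReal.ofReal (l ^ 2)
      ≤ volume {x | ENNReal.ofReal (l ^ 2) ≤ ‖f x‖ₑ ^ 2} * ENNReal.ofReal (l ^ 2) := by
        gcongr
    _ = ENNReal.ofReal (l ^ 2) * volume {x | ENNReal.ofReal (l ^ 2) ≤ ‖f x‖ₑ ^ 2} := mul_comm _ _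
    _ ≤ ∫⁻ x, ‖f x‖ₑ ^ 2 := mul_meas_ge_le_lintegral₀ hmeas _

/-- **Layer cake**: `∫ |f|³ = 3 ∫₀^∞ t² |{‖f‖ > t}| dt`. -/
theorem lintegral_cube_eq_layerCake {f : (EuclideanSpace ℝ (Fin 3)) → (EuclideanSpace ℝ (Fin 3))} (hf : Continuous f) :
    ∫⁻ x, ‖f x‖ₑ ^ (3 : ℕ) =
      ENNReal.ofReal 3 * ∫⁻ t in Ioi (0 : ℝ), volume {x | t < ‖f x‖} * ENNReal.ofReal (t ^ 2) := by
  have h := lintegral_rpow_eq_lintegral_meas_lt_mul volume (f := fun x => ‖f x‖)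
    (Eventually.of_forall fun x => norm_nonneg (f x)) hf.norm.aemeasurable (p := 3) (by norm_num)
  have hL : ∫⁻ x, ‖f x‖ₑ ^ (3 : ℕ) = ∫⁻ x, ENNReal.ofReal (‖f x‖ ^ (3 : ℝ)) := by
    refine lintegral_congr fun x => ?_
    rw [← ofReal_norm, ← ENNReal.ofReal_pow (norm_nonneg _), ← Real.rpow_natCast]
    norm_num
  rw [hL, h]
  congr 1
  refine setLIntegral_congr_fun measurableSet_Ioi fun t _ => ?_
  congr 2
  norm_num

/-- **The two-parameter bound**: for every split level `Λ > 0`,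
`∫|f|³ ≤ 3 (‖f‖₂² Λ + (16 M₂ / V₁) ‖∇f‖₂² Λ⁻¹)`. -/
theorem lintegral_cube_le_split {f : (EuclideanSpace ℝ (Fin 3)) → (EuclideanSpace ℝ (Fin 3))} (hf : ContDiff ℝ 1 f)
    {M₂ : ℝ} (hM₂ : 0 < M₂)
    (hMor : ∀ (x₀ : EuclideanSpace ℝ (Fin 3)) (ρ : ℝ), 0 < ρ →
      ∫⁻ y in closedBall x₀ ρ, ‖f y‖ₑ ^ 2 ≤ ENNReal.ofReal (M₂ * ρ))
    {Λ : ℝ} (hΛ : 0 < Λ) :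
    ∫⁻ x, ‖f x‖ₑ ^ (3 : ℕ) ≤
      (3 * ∫⁻ x, ‖f x‖ₑ ^ 2) * ENNReal.ofReal Λ +
        (3 * (ENNReal.ofReal (16 * M₂ / V₁) * ∫⁻ x, ‖fderiv ℝ f x‖ₑ ^ 2)) * ENNReal.ofReal Λ⁻¹ := by
  have hV : 0 < V₁ := by
    rw [V₁]
    exact ENNReal.toReal_pos (measure_ball_pos volume (0 : EuclideanSpace ℝ (Fin 3)) one_pos).ne'
      measure_ball_lt_top.ne
  have hfc : Continuous f := hf.continuous
  set e : ℝ≥0∞ := ∫⁻ x, ‖f x‖ₑ ^ 2 with he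
  set D : ℝ≥0∞ := ∫⁻ x, ‖fderiv ℝ f x‖ₑ ^ 2 with hD
  set G : ℝ → ℝ≥0∞ := fun t => volume {x | t < ‖f x‖} * ENNReal.ofReal (t ^ 2) with hG
  -- small levels: `G t ≤ e`
  have hsmall : ∀ t ∈ Ioc (0 : ℝ) Λ, G t ≤ e := fun t ht => meas_gt_mul_le_energy hfc ht.1
  -- large levels: `G t ≤ (16 M₂ / V₁) D t⁻²`
  have hlarge : ∀ t ∈ Ioi Λ, G t ≤ (ENNReal.ofReal (16 * M₂ / V₁) * D) * ENNReal.ofReal (t ^ (-2 : ℝ)) := by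
    intro t ht
    have ht0 : 0 < t := hΛ.trans ht
    have h1 := meas_gt_mul_le_of_morrey hf hM₂ hMor ht0
    have hρ2 : (2 * Real.sqrt (M₂ / V₁) / t) ^ 2 = 4 * (M₂ / V₁) / t ^ 2 := by
      rw [div_pow, mul_pow, Real.sq_sqrt (by positivity)]
      ring
    rw [hρ2] at h1
    have ht2 : ENNReal.ofReal (t ^ 2) = ENNReal.ofReal ((t / 2) ^ 2) * ENNReal.ofReal 4 := by
      rw [← ENNReal.ofReal_mul (by positivity)]
      congr 1
      ring
    calc G t = volume {x | t < ‖f x‖} * ENNReal.ofReal ((t / 2) ^ 2) * ENNReal.ofReal 4 := by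
          rw [hG]
          simp only
          rw [ht2, mul_assoc]
      _ ≤ ENNReal.ofReal (4 * (M₂ / V₁) / t ^ 2) * D * ENNReal.ofReal 4 := by gcongr
      _ = (ENNReal.ofReal (16 * M₂ / V₁) * D) * ENNReal.ofReal (t ^ (-2 : ℝ)) := by
          rw [mul_assoc, mul_comm D, ← mul_assoc, ← ENNReal.ofReal_mul (by positivity),
            mul_assoc, mul_comm D, ← mul_assoc, ← ENNReal.ofReal_mul (by positivity)]
          congr 2
          rw [Real.rpow_neg ht0.le, Real.rpow_two]
          field_simp
          ring
  -- the tail integral `∫_Λ^∞ t⁻² dt = Λ⁻¹`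
  have htail : ∫⁻ t in Ioi Λ, ENNReal.ofReal (t ^ (-2 : ℝ)) = ENNReal.ofReal Λ⁻¹ := by
    rw [← ofReal_integral_eq_lintegral_ofReal (integrableOn_Ioi_rpow_of_lt (by norm_num) hΛ)]
    · rw [integral_Ioi_rpow_of_lt (by norm_num) hΛ]
      congr 1
      norm_num
      rw [Real.rpow_neg_one]
    · exact (ae_restrict_iff' measurableSet_Ioi).2 (Eventually.of_forall fun t ht =>
        Real.rpow_nonneg (hΛ.trans ht).le _)
  -- assemble
  rw [lintegral_cube_eq_layerCake hfc, ← Ioc_union_Ioi_eq_Ioi hΛ.le,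
    lintegral_union measurableSet_Ioi Ioc_disjoint_Ioi_same]
  have hI1 : ∫⁻ t in Ioc (0 : ℝ) Λ, G t ≤ e * ENNReal.ofReal Λ := by
    calc ∫⁻ t in Ioc (0 : ℝ) Λ, G t ≤ ∫⁻ t in Ioc (0 : ℝ) Λ, e := setLIntegral_mono' measurableSet_Ioc hsmall
      _ = e * ENNReal.ofReal Λ := by rw [setLIntegral_const, Real.volume_Ioc, sub_zero]
  have hI2 : ∫⁻ t in Ioi Λ, G t ≤ (ENNReal.ofReal (16 * M₂ / V₁) * D) * ENNReal.ofReal Λ⁻¹ := by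
    calc ∫⁻ t in Ioi Λ, G t
        ≤ ∫⁻ t in Ioi Λ, (ENNReal.ofReal (16 * M₂ / V₁) * D) * ENNReal.ofReal (t ^ (-2 : ℝ)) :=
          setLIntegral_mono' measurableSet_Ioi hlarge
      _ = (ENNReal.ofReal (16 * M₂ / V₁) * D) * ∫⁻ t in Ioi Λ, ENNReal.ofReal (t ^ (-2 : ℝ)) := by
          rw [lintegral_const_mul]
          exact (measurable_id.pow_const _).ennreal_ofReal
      _ = (ENNReal.ofReal (16 * M₂ / V₁) * D) * ENNReal.ofReal Λ⁻¹ := by rw [htail]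
  have h3 : ENNReal.ofReal 3 = 3 := by norm_num
  show ENNReal.ofReal 3 * ((∫⁻ t in Ioc (0 : ℝ) Λ, G t) + ∫⁻ t in Ioi Λ, G t) ≤ _
  calc ENNReal.ofReal 3 * ((∫⁻ t in Ioc (0 : ℝ) Λ, G t) + ∫⁻ t in Ioi Λ, G t)
      ≤ ENNReal.ofReal 3 * (e * ENNReal.ofReal Λ + (ENNReal.ofReal (16 * M₂ / V₁) * D) * ENNReal.ofReal Λ⁻¹) := by
        gcongr
    _ = (3 * e) * ENNReal.ofReal Λ + (3 * (ENNReal.ofReal (16 * M₂ / V₁) * D)) * ENNReal.ofReal Λ⁻¹ := by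
        rw [h3]
        ring

/-! ### §4  Optimising the split level -/

/-- If `X ≤ a Λ + b Λ⁻¹` for every `Λ > 0` (`a, b` finite), then `X² ≤ 4 a b`. -/
theorem sq_le_of_forall_le_linear_add_inv {X a b : ℝ≥0∞} (ha : a ≠ ⊤) (hb : b ≠ ⊤)
    (h : ∀ Λ : ℝ, 0 < Λ → X ≤ a * ENNReal.ofReal Λ + b * ENNReal.ofReal Λ⁻¹) :
    X ^ 2 ≤ 4 * a * b := by
  rcases eq_or_ne a 0 with rfl | ha0
  · -- `X ≤ b / Λ` for all `Λ`: `X = 0`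
    have hX : X ≤ 0 := by
      refine ENNReal.le_of_forall_pos_le_add fun ε hε _ => ?_
      have hΛ : 0 < b.toReal / ε + 1 := by positivity
      calc X ≤ 0 * ENNReal.ofReal (b.toReal / ε + 1) + b * ENNReal.ofReal (b.toReal / ε + 1)⁻¹ := h _ hΛ
        _ = ENNReal.ofReal (b.toReal * (b.toReal / ε + 1)⁻¹) := by
            rw [zero_mul, zero_add, ENNReal.ofReal_mul ENNReal.toReal_nonneg, ENNReal.ofReal_toReal hb]
        _ ≤ ENNReal.ofReal ε := by
            refine ENNReal.ofReal_le_ofReal ?_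
            rw [← div_eq_mul_inv, div_le_iff₀ hΛ]
            have : (0 : ℝ) < ε := hε
            nlinarith [ENNReal.toReal_nonneg (a := b), mul_div_cancel₀ b.toReal this.ne']
        _ = 0 + ε := by rw [ENNReal.ofReal_coe_nnreal, zero_add]
    have hX0 : X = 0 := le_antisymm hX bot_le
    rw [hX0]
    simp
  rcases eq_or_ne b 0 with rfl | hb0
  · have hX : X ≤ 0 := by
      refine ENNReal.le_of_forall_pos_le_add fun ε hε _ => ?_
      have hΛ : 0 < (ε : ℝ) / (a.toReal + 1) := by
        have : (0 : ℝ) < ε := hε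
        positivity
      calc X ≤ a * ENNReal.ofReal ((ε : ℝ) / (a.toReal + 1)) + 0 * ENNReal.ofReal ((ε : ℝ) / (a.toReal + 1))⁻¹ :=
            h _ hΛ
        _ = ENNReal.ofReal (a.toReal * ((ε : ℝ) / (a.toReal + 1))) := by
            rw [zero_mul, add_zero, ENNReal.ofReal_mul ENNReal.toReal_nonneg, ENNReal.ofReal_toReal ha]
        _ ≤ ENNReal.ofReal ε := by
            refine ENNReal.ofReal_le_ofReal ?_
            rw [mul_div_assoc', div_le_iff₀ (by positivity)]
            have : (0 : ℝ) < ε := hε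
            nlinarith [ENNReal.toReal_nonneg (a := a)]
        _ = 0 + ε := by rw [ENNReal.ofReal_coe_nnreal, zero_add]
    have hX0 : X = 0 := le_antisymm hX bot_le
    rw [hX0]
    simp
  -- main case: `a, b ∈ (0, ∞)`, take `Λ = √(b/a)`
  set α : ℝ := a.toReal with hα
  set β : ℝ := b.toReal with hβ
  have hαpos : 0 < α := ENNReal.toReal_pos ha0 ha
  have hβpos : 0 < β := ENNReal.toReal_pos hb0 hb
  set Λ : ℝ := Real.sqrt (β / α) with hΛdef
  have hΛ : 0 < Λ := Real.sqrt_pos.2 (div_pos hβpos hαpos)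
  have hΛsq : Λ ^ 2 = β / α := Real.sq_sqrt (div_pos hβpos hαpos).le
  have h1 : α * Λ = Real.sqrt (α * β) := by
    rw [hΛdef, ← Real.sqrt_sq hαpos.le, ← Real.sqrt_mul (sq_nonneg α), Real.sqrt_sq hαpos.le]
    congr 1
    field_simp
  have h2 : β * Λ⁻¹ = Real.sqrt (α * β) := by
    have hΛne : Λ ≠ 0 := hΛ.ne'
    have hβ' : β = α * Λ ^ 2 := by rw [hΛsq]; field_simp
    calc β * Λ⁻¹ = α * Λ ^ 2 * Λ⁻¹ := by rw [hβ']
      _ = α * Λ := by field_simp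
      _ = Real.sqrt (α * β) := h1
  have hX : X ≤ ENNReal.ofReal (2 * Real.sqrt (α * β)) := by
    calc X ≤ a * ENNReal.ofReal Λ + b * ENNReal.ofReal Λ⁻¹ := h Λ hΛ
      _ = ENNReal.ofReal (α * Λ) + ENNReal.ofReal (β * Λ⁻¹) := by
          rw [← ENNReal.ofReal_toReal ha, ← ENNReal.ofReal_toReal hb, ← hα, ← hβ,
            ← ENNReal.ofReal_mul hαpos.le, ← ENNReal.ofReal_mul hβpos.le]
      _ = ENNReal.ofReal (2 * Real.sqrt (α * β)) := by
          rw [h1, h2, ← ENNReal.ofReal_add (Real.sqrt_nonneg _) (Real.sqrt_nonneg _), two_mul]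
  calc X ^ 2 ≤ (ENNReal.ofReal (2 * Real.sqrt (α * β))) ^ 2 := pow_le_pow_left' hX 2
    _ = ENNReal.ofReal (4 * α * β) := by
        rw [← ENNReal.ofReal_pow (by positivity)]
        congr 1
        rw [mul_pow, Real.sq_sqrt (by positivity)]
        ring
    _ = 4 * a * b := by
        rw [ENNReal.ofReal_mul (by positivity), ENNReal.ofReal_mul (by positivity), hα, hβ,
          ENNReal.ofReal_toReal ha, ENNReal.ofReal_toReal hb]
        norm_num

/-- **THE SLICE INEQUALITY** (elementary replacement of Maz'ya's trace inequality): for a `C¹` field on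
`ℝ³` with `∫_{B̄(x₀,ρ)} |f|² ≤ M₂ ρ` for all centres and radii and `‖f‖₂ < ∞`,
`(∫ |f|³)² ≤ (576 M₂ / V₁) · ‖f‖₂² · ‖∇f‖₂²`, i.e. `‖f‖₃³ ≤ 24 (M₂/V₁)^{1/2} ‖f‖₂ ‖∇f‖₂`. -/
theorem lintegral_cube_sq_le_of_morrey {f : (EuclideanSpace ℝ (Fin 3)) → (EuclideanSpace ℝ (Fin 3))}
    (hf : ContDiff ℝ 1 f) {M₂ : ℝ} (hM₂ : 0 < M₂)
    (hMor : ∀ (x₀ : EuclideanSpace ℝ (Fin 3)) (ρ : ℝ), 0 < ρ →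
      ∫⁻ y in closedBall x₀ ρ, ‖f y‖ₑ ^ 2 ≤ ENNReal.ofReal (M₂ * ρ))
    (he : ∫⁻ x, ‖f x‖ₑ ^ 2 ≠ ⊤) :
    (∫⁻ x, ‖f x‖ₑ ^ (3 : ℕ)) ^ 2 ≤
      ENNReal.ofReal (576 * M₂ / V₁) * (∫⁻ x, ‖f x‖ₑ ^ 2) * ∫⁻ x, ‖fderiv ℝ f x‖ₑ ^ 2 := by
  have hV : 0 < V₁ := by
    rw [V₁]
    exact ENNReal.toReal_pos (measure_ball_pos volume (0 : EuclideanSpace ℝ (Fin 3)) one_pos).ne'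
      measure_ball_lt_top.ne
  have hfc : Continuous f := hf.continuous
  set e : ℝ≥0∞ := ∫⁻ x, ‖f x‖ₑ ^ 2 with hedef
  set D : ℝ≥0∞ := ∫⁻ x, ‖fderiv ℝ f x‖ₑ ^ 2 with hDdef
  rcases eq_or_ne e 0 with he0 | he0
  · -- `f = 0` a.e.
    have hae : ∀ᵐ x ∂volume, ‖f x‖ₑ ^ 2 = 0 :=
      (lintegral_eq_zero_iff' ((hfc.measurable.enorm.pow_const 2).aemeasurable)).1 he0
    have h0 : ∫⁻ x, ‖f x‖ₑ ^ (3 : ℕ) = 0 := by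
      refine (lintegral_eq_zero_iff' ((hfc.measurable.enorm.pow_const 3).aemeasurable)).2 ?_
      filter_upwards [hae] with x hx
      simp only [Pi.zero_apply, pow_eq_zero_iff, ne_eq, OfNat.ofNat_ne_zero, not_false_eq_true] at hx ⊢
      exact hx
    rw [h0]
    simp
  rcases eq_or_ne D ⊤ with hDtop | hDtop
  · rw [hDtop, ENNReal.mul_top]
    · exact le_top
    · exact mul_ne_zero (by simp [ENNReal.ofReal_eq_zero, not_le]; positivity) he0
  have ha : 3 * e ≠ ⊤ := ENNReal.mul_ne_top (by norm_num) he
  have hb : 3 * (ENNReal.ofReal (16 * M₂ / V₁) * D) ≠ ⊤ :=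
    ENNReal.mul_ne_top (by norm_num) (ENNReal.mul_ne_top ENNReal.ofReal_ne_top hDtop)
  have h := sq_le_of_forall_le_linear_add_inv ha hb fun Λ hΛ => lintegral_cube_le_split hf hM₂ hMor hΛ
  refine h.trans (le_of_eq ?_)
  have h576 : ENNReal.ofReal (576 * M₂ / V₁) = 36 * ENNReal.ofReal (16 * M₂ / V₁) := by
    rw [show (36 : ℝ≥0∞) = ENNReal.ofReal 36 by norm_num, ← ENNReal.ofReal_mul (by norm_num)]
    congr 1
    ring
  rw [h576]
  ring


end Summit.NavierStokesRegularity.NavierStokesRegularity.Theorems.L3TimeExponentPincerMorreyInterpolation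

end
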